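import Summits.BirchSwinnertonDyer.Rank1Residual.X11b.AnticyclotomicGoodPlaces
import Summits.BirchSwinnertonDyer.Rank1Residual.X11b.AnticyclotomicInfinitePlaces
import Summits.BirchSwinnertonDyer.Rank1Residual.X11b.AnticyclotomicControlCount
import HarnessLib

/-!
# X11b, route R1 — the BAD-IMPRIMITIVE control map `Sel_𝔭^Σ(K, E[p^∞]) → Sel_𝔭^Σ(K_∞, E[p^∞])^Γ`
# is an ISOMORPHISM (`Σ ⊇ {bad v ∤ p}`; any `ℤ_p`-extension of a totally complex `K`)

HONEST FRAMING (cell `b2b-bsdres`, run/shared/lean/b2b/bsd-rank1-residual/, verbatim in every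
file): the goal of the cell is to DELETE the COMBINATION-SHAPED residual classes of the
Birch–Swinnerton-Dyer formula for ALL analytic-rank `≤ 1` elliptic curves over `ℚ` — "full BSD
formula for every rank `≤ 1` curve in class `C`" assembled STRICTLY from published theorems — so
that the rank-`≤ 1` remainder becomes exactly the CONSTRUCTION-SHAPED classes, which are TYPED
(missing-input `Prop`s), NOT attempted. This is not "finishing BSD". Sub-cell
`b2b-bsdres-multr1-p1` (X11b, route R1 = Castella 2018 Thm. A re-proved along the author's
erratum); a RESEARCH ROUTE; no claim beyond the stated class; X11b stays CONSTRUCTION-SHAPED;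
nothing here changes a label; no named fact is minted (proved theorems only; no `sorry`).

## Why this file

`AnticyclotomicControlCokernel` / `AnticyclotomicInfinitePlaces` (gen 10) proved: for totally complex
`K`, the control map `s : Sel_𝔭^Σ(K, E[p^∞]) → Sel_𝔭^Σ(K_∞, E[p^∞])^γ` (Castella's Selmer group of
Cas18 Def. 2.2, JSW17 §3.3.2's `s`, Greenberg's `s₀`) is BIJECTIVE as soon as (a)
`H¹(K, E[p^∞]) ↪ H¹(K_∞, E[p^∞])`, (b) `E(K̄)[p^∞]^{D_𝔭 ⊓ ker κ} = 0` at the strict place, and (c) the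
AWAY conditions at the finite `v ∉ Σ`, `v ∤ p` descend (`controlMap_bijective_of_away_descent`).
`AnticyclotomicGoodPlaces` (this gen) proved that (c) holds at every place of GOOD reduction `v ∤ p`
for every `ℤ_p`-extension (Greenberg LNM 1716 Lemma 3.3, good case: `H¹(D_v, E[p^∞]) ↪ H¹(I_v, E[p^∞])`).
Hence:

* `away_descent_of_bad_subset`: hypothesis (c) HOLDS for every `Σ ⊇ {v ∤ p : E has bad reduction at v}`;
* **`controlMap_bijective_of_bad_subset`**: for totally complex `K`, ANY elliptic `E/K`, ANY
  `ℤ_p`-extension `κ` with topological generator `γ`, any `𝔭` with (b), (a), and ANY such `Σ`: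
  **`s` is BIJECTIVE** — Greenberg's control theorem with EXACT control for the non-primitive
  (bad-imprimitive) strict Selmer group (Lemma 3.1 injective; Lemma 3.2 + local kernels: `0` at good
  `v ∤ p`, nothing to check at `v ∈ Σ` and at the relaxed `v ∣ p`, (iv) at `𝔭`, `K_w = ℂ` at `∞`);
* route R1: **`ChainLocus.controlMap_bijective_of_bad_subset`** (every imaginary quadratic `K`,
  degree-one `𝔭 ∣ p`, every `κ`; (a) from `Irr ∧ Ram`, (b) from the erratum's (iv) — gens 9–10) and
  `…_of_isErratumField`.

Consequence for the typed control input `R1ControlOnTreeAt` (Cas18 Thm. 2.3, `Σ = ∅`, with the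
Tamagawa term `∏_{w∣N⁺} c_w^{(p)}`): combined with `XAc.hasCharValuationAt_iff_card_base` (gen 10,
`AnticyclotomicControlCount`), for `Σ ⊇ {bad v ∤ p}` the statement "`ord_p f_ac^Σ(0) = n`" is now
EQUIVALENT, with NO residual descent input, to `#Sel_𝔭^Σ(K, E[p^∞]) = p^n · #Sel_𝔭^Σ(K_∞, E[p^∞])_γ`.
What remains of JSW §3.3 / Cas18 Thm. 2.3 beyond this file: the passage `Σ → ∅` (the local kernels of
order `c_w^{(p)}` at the bad finitely-decomposed `w ∤ p`, i.e. the Tamagawa factors), the order of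
`Sel_𝔭(K, E[p^∞])` (JSW §3.3.5, Poitou–Tate) and `Sel_Γ = 0` (§3.3.6). No label changes.

References: [GreenbergLNM1716] §3 Lemmas 3.1–3.3, p. 90 (Thm. 1.2); [JetchevSkinnerWan2017] §3.3
(arXiv:1512.06894; shape only); [Castella2018] Def. 2.2, Thm. 2.3 (arXiv:1704.06608 p. 5).
-/

noncomputable section

open scoped Classical

open NumberField IsDedekindDomain Field
open Literature.NumberTheory.EllipticCurves Literature.NumberTheory.EllipticCurves.GreenbergSelmer
open Literature.NumberTheory.GaloisRepresentations IsDedekindDomain.HeightOneSpectrum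

namespace Summit.BirchSwinnertonDyer.Rank1Residual.X11b.AcSelmer

section Curve

variable {K : Type} [Field K] [NumberField K] (E : WeierstrassCurve K) [E.IsElliptic]
  (p : ℕ) [Fact p.Prime]

/-! ## The bad-imprimitive control map is an isomorphism -/

variable (κ : ZpExtension K p) (𝔭 : HeightOneSpectrum (𝓞 K)) (S : Set (HeightOneSpectrum (𝓞 K)))

/-- **The hypothesis `hS` of `controlMap_bijective_of_away_descent` HOLDS when `Σ ⊇ {bad v ∤ p}`**:
if `res_{K→K_∞} c ∈ Sel_𝔭^Σ(K_∞, E[p^∞])` then `c` is locally trivial at every `v ∉ Σ`, `v ∤ p` — such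
`v` are good, and the away condition descends there. [cite: GreenbergLNM1716, §3 Lemma 3.3 (p. 87) and p. 90] -/
theorem away_descent_of_bad_subset
    (hS : ∀ v : HeightOneSpectrum (𝓞 K), (p : 𝓞 K) ∉ v.asIdeal → ¬ E.HasGoodReductionAt v → v ∈ S)
    (c : E.subgroupH1 p (⊤ : Subgroup (absoluteGaloisGroup K)))
    (hc : resOfLe (E.geomPrimaryTorsion p) (le_top : κ.kerSubgroup ≤ ⊤) c ∈ selmerAc E p κ 𝔭 S)
    (v : HeightOneSpectrum (𝓞 K)) (hpv : ((p : ℕ) : 𝓞 K) ∉ v.asIdeal) (hvS : v ∉ S) :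
    c ∈ awayKer ⊤ (E.geomPrimaryTorsion p) v := by
  have hgood : E.HasGoodReductionAt v := by
    by_contra h
    exact hvS (hS v hpv h)
  have h1 := ((mem_selmerOver_iff _).mp hc).1 v hpv hvS 1
  rw [conjH1_one_holds, AddMonoidHom.id_apply] at h1
  exact (resOfLe_mem_awayKer_kerSubgroup_iff_of_hasGoodReductionAt E p κ hpv hgood c).mp h1

/-- **The bad-imprimitive anticyclotomic/cyclotomic control map is BIJECTIVE.** For a totally complex
number field `K`, an elliptic curve `E/K`, a prime `p`, ANY `ℤ_p`-extension `κ` with topological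
generator `γ`, a prime `𝔭` with `E(K̄)[p^∞]^{D_𝔭 ⊓ ker κ} = 0` (the strict place; e.g. degree-one
`𝔭 ∣ p` under (iv)), `H¹(K, E[p^∞]) ↪ H¹(K_∞, E[p^∞])` (e.g. `E(K_∞)[p^∞] = 0`), and ANY set `Σ` of
finite places containing the places `v ∤ p` of bad reduction:
`s : Sel_𝔭^Σ(K, E[p^∞]) → Sel_𝔭^Σ(K_∞, E[p^∞])^γ` is bijective — Greenberg's control theorem with
exact control for the non-primitive Selmer group (injective: Lemma 3.1; onto: Lemma 3.2 + the local
kernels: `0` at good `v ∤ p` (this file), nothing to check at `v ∈ Σ` and at the relaxed `v ∣ p`,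
(iv) at `𝔭`, `K_w = ℂ` at infinity). [cite: GreenbergLNM1716, §3 Lemmas 3.1–3.3 and p. 90 (Thm. 1.2)]
[cite: JetchevSkinnerWan2017, §3.3 (anticyclotomic control; shape only)] [cite: Castella2018, Def. 2.2 and Thm. 2.3 (arXiv:1704.06608 p. 5)] -/
theorem controlMap_bijective_of_bad_subset [IsTotallyComplex K] {γ : absoluteGaloisGroup K}
    (hγ : κ.IsTopGenerator γ)
    (hinj : Function.Injective (ResKernel.resSubgroup κ.kerSubgroup (E.geomPrimaryTorsion p)))
    (h0 : FixedPoints.addSubgroup ↥(decomp 𝔭 ⊓ κ.kerSubgroup) (E.geomPrimaryTorsion p) = ⊥)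
    (hS : ∀ v : HeightOneSpectrum (𝓞 K), (p : 𝓞 K) ∉ v.asIdeal → ¬ E.HasGoodReductionAt v → v ∈ S) :
    Function.Bijective (controlMap E p κ 𝔭 S γ) :=
  controlMap_bijective_of_away_descent E p κ 𝔭 S hγ hinj h0
    (fun c hc v hpv hvS ↦ away_descent_of_bad_subset E p κ 𝔭 S hS c hc v hpv hvS)

/-- **Counting form with NO descent input** (totally complex `K`, finite `Σ ⊇ {bad v ∤ p}`): under
`H¹(K, E[p^∞]) ↪ H¹(K_∞, E[p^∞])` and `E(K̄)[p^∞]^{D_𝔭 ⊓ ker κ} = 0`, "`ord_p f_ac^Σ(0) = n`" for the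
constructed `X_ac^Σ(E[p^∞])` ⟺ `Sel_𝔭^Σ(K, E[p^∞])` is finite with
`#Sel_𝔭^Σ(K, E[p^∞]) = p^n · #Sel_𝔭^Σ(K_∞, E[p^∞])_γ` (gen 9's Euler-characteristic form through the
bijective `s`; `X_ac^Σ` finitely generated for finite `Σ`, `XAc.module_finite`).
[cite: GreenbergLNM1716, §4 Lemma 4.2 (p. 102) and §3 Lemma 3.3] [cite: JetchevSkinnerWan2017, §3.3 (shape only)] -/
theorem XAc.hasCharValuationAt_iff_card_base_of_bad_subset [IsTotallyComplex K]
    (γ : absoluteGaloisGroup K) [hγ : Fact (κ.IsTopGenerator γ)] (hSfin : S.Finite)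
    (hinj : Function.Injective (ResKernel.resSubgroup κ.kerSubgroup (E.geomPrimaryTorsion p)))
    (h0 : FixedPoints.addSubgroup ↥(decomp 𝔭 ⊓ κ.kerSubgroup) (E.geomPrimaryTorsion p) = ⊥)
    (hS : ∀ v : HeightOneSpectrum (𝓞 K), (p : 𝓞 K) ∉ v.asIdeal → ¬ E.HasGoodReductionAt v → v ∈ S)
    (n : ℕ) :
    XAc.HasCharValuationAt E p κ 𝔭 S γ n ↔
      ∃ _ : Finite (selmerAcBase E p 𝔭 S),
        Nat.card (selmerAcBase E p 𝔭 S) =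
          p ^ n * Nat.card (IwasawaDual.EndCoinvariants (conjSelmerAc E p κ 𝔭 S γ - 1)) := by
  haveI := XAc.module_finite κ 𝔭 S γ hSfin (W := E)
  exact XAc.hasCharValuationAt_iff_card_base E p κ 𝔭 S γ
    (controlMap_bijective_of_bad_subset E p κ 𝔭 S hγ.out hinj h0 hS) n

end Curve

end Summit.BirchSwinnertonDyer.Rank1Residual.X11b.AcSelmer

/-! ## Route R1: `ChainLocus`, imaginary quadratic `K` / erratum fields -/

namespace Summit.BirchSwinnertonDyer.Rank1Residual.X11b

section RouteR1

open AcSelmer Literature.NumberTheory.EllipticCurves.Rank1Residual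

variable {W : WeierstrassCurve ℚ} [W.IsElliptic] [W.IsGloballyMinimal] {p : ℕ} [Fact p.Prime]

/-- **Exact control for route R1's bad-imprimitive Selmer group.** On route R1's population
(`ChainLocus`), for EVERY imaginary quadratic `K`, EVERY degree-one `𝔭 ∣ p`, EVERY `ℤ_p`-extension `κ`
with topological generator `γ` (in particular the anticyclotomic one), and every `Σ` containing the
places `v ∤ p` of bad reduction of `E_K`: `s : Sel_𝔭^Σ(K, E[p^∞]) → Sel_𝔭^Σ(K_∞, E[p^∞])^γ` is BIJECTIVE —
no residual input (injectivity from `Irr ∧ Ram`, the strict place from (iv), the good places from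
Lemma 3.3). What Cas18 Thm. 2.3 / (5.2) needs beyond this is the passage `Σ → ∅` (the Tamagawa
factors at the bad split places) and the order of `Sel_𝔭(K, E[p^∞])`.
[cite: Castella2018, Thm. 2.3 (arXiv:1704.06608 p. 5) (shape only)] [cite: JetchevSkinnerWan2017, §3.3 (shape only)] [cite: GreenbergLNM1716, §3 pp. 85–90] -/
theorem ChainLocus.controlMap_bijective_of_bad_subset (h : ChainLocus W p)
    (K : Type) [Field K] [NumberField K] (hK : IsImaginaryQuadratic K) (κ : ZpExtension K p)
    {γ : absoluteGaloisGroup K} (hγ : κ.IsTopGenerator γ) (𝔭 : HeightOneSpectrum (𝓞 K))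
    (h𝔭 : ((p : ℕ) : 𝓞 K) ∈ 𝔭.asIdeal) (he : 𝔭.asIdeal.ramificationIdx (𝓞 ℚ) = 1)
    (hf : 𝔭.asIdeal.inertiaDeg (𝓞 ℚ) = 1) (S : Set (HeightOneSpectrum (𝓞 K)))
    (hS : ∀ v : HeightOneSpectrum (𝓞 K), (p : 𝓞 K) ∉ v.asIdeal →
      ¬ (W.baseChange K).HasGoodReductionAt v → v ∈ S) :
    Function.Bijective (controlMap (W.baseChange K) p κ 𝔭 S γ) :=
  h.controlMap_bijective_of_away_descent K hK κ hγ 𝔭 h𝔭 he hf S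
    (fun c hc v hpv hvS ↦ away_descent_of_bad_subset (W.baseChange K) p κ 𝔭 S hS c hc v hpv hvS)

/-- **On an erratum field** (`IsErratumField`: imaginary quadratic, `p ∣ N_E` split): exact control of
the bad-imprimitive Selmer group for every `𝔭 ∋ p`, every `κ`, `γ`, every `Σ ⊇ {bad v ∤ p}`.
[cite: Castella2018, §5 (arXiv:1704.06608 p. 12), choice of K] [cite: Castella2018, Thm. 2.3 (arXiv:1704.06608 p. 5) (shape only)] -/
theorem ChainLocus.controlMap_bijective_of_bad_subset_of_isErratumField (h : ChainLocus W p)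
    {q : ℕ} (K : Type) [Field K] [NumberField K] (hKf : IsErratumField W K q) (hpq : p ≠ q)
    (hpN : p ∣ W.conductorNorm ℤ) (κ : ZpExtension K p)
    {γ : absoluteGaloisGroup K} (hγ : κ.IsTopGenerator γ) (𝔭 : HeightOneSpectrum (𝓞 K))
    (h𝔭 : ((p : ℕ) : 𝓞 K) ∈ 𝔭.asIdeal) (S : Set (HeightOneSpectrum (𝓞 K)))
    (hS : ∀ v : HeightOneSpectrum (𝓞 K), (p : 𝓞 K) ∉ v.asIdeal →
      ¬ (W.baseChange K).HasGoodReductionAt v → v ∈ S) :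
    Function.Bijective (controlMap (W.baseChange K) p κ 𝔭 S γ) :=
  have hsplit : SplitsIn K p := hKf.2.2.1 p (Fact.out : p.Prime) hpN hpq
  h.controlMap_bijective_of_bad_subset K hKf.1 κ hγ 𝔭 h𝔭
    (degreeOne_of_splitsIn hKf.1.1 hsplit h𝔭).1 (degreeOne_of_splitsIn hKf.1.1 hsplit h𝔭).2 S hS

/-- **Route R1, counting form of the bad-imprimitive control step, NO residual input.** On
`ChainLocus`, for every imaginary quadratic `K`, every degree-one `𝔭 ∣ p`, every `ℤ_p`-extension `κ`
with topological generator `γ`, and every FINITE `Σ ⊇ {bad v ∤ p}`: "`ord_p f_ac^Σ(0) = n`" for the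
constructed `X_ac^Σ(E[p^∞])` ⟺ `Sel_𝔭^Σ(K, E[p^∞])` is finite and
`#Sel_𝔭^Σ(K, E[p^∞]) = p^n · #H¹(Γ, Sel_𝔭^Σ(K_∞, E[p^∞]))`. (Compare `ChainLocus.hasCharValuationAt_iff_card_base`,
`Σ = ∅`, which carries the away-descent hypothesis: with `Σ ⊇ {bad v ∤ p}` it is discharged.)
[cite: Castella2018, Thm. 2.3 (arXiv:1704.06608 p. 5) (shape only)] [cite: JetchevSkinnerWan2017, §3.3.6 (shape only)] [cite: GreenbergLNM1716, §4 Lemma 4.2 (p. 102)] -/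
theorem ChainLocus.hasCharValuationAt_iff_card_base_of_bad_subset (h : ChainLocus W p)
    (K : Type) [Field K] [NumberField K] (hK : IsImaginaryQuadratic K) (κ : ZpExtension K p)
    (γ : absoluteGaloisGroup K) [hγ : Fact (κ.IsTopGenerator γ)] (𝔭 : HeightOneSpectrum (𝓞 K))
    (h𝔭 : ((p : ℕ) : 𝓞 K) ∈ 𝔭.asIdeal) (he : 𝔭.asIdeal.ramificationIdx (𝓞 ℚ) = 1)
    (hf : 𝔭.asIdeal.inertiaDeg (𝓞 ℚ) = 1) {S : Set (HeightOneSpectrum (𝓞 K))} (hSfin : S.Finite)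
    (hS : ∀ v : HeightOneSpectrum (𝓞 K), (p : 𝓞 K) ∉ v.asIdeal →
      ¬ (W.baseChange K).HasGoodReductionAt v → v ∈ S) (n : ℕ) :
    XAc.HasCharValuationAt (W.baseChange K) p κ 𝔭 S γ n ↔
      ∃ _ : Finite (selmerAcBase (W.baseChange K) p 𝔭 S),
        Nat.card (selmerAcBase (W.baseChange K) p 𝔭 S) =
          p ^ n * Nat.card (IwasawaDual.EndCoinvariants
            (conjSelmerAc (W.baseChange K) p κ 𝔭 S γ - 1)) := by
  haveI := XAc.module_finite κ 𝔭 S γ hSfin (W := W.baseChange K)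
  exact XAc.hasCharValuationAt_iff_card_base (W.baseChange K) p κ 𝔭 S γ
    (h.controlMap_bijective_of_bad_subset K hK κ hγ.out 𝔭 h𝔭 he hf S hS) n

end RouteR1

end Summit.BirchSwinnertonDyer.Rank1Residual.X11b

end
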